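import Summits.ResolutionOfSingularities.ResolutionOfSingularities.Theorems.FrobeniusLadderFRationalResolutionFixedPointTwoStepModelIsolated
import Summits.ResolutionOfSingularities.ResolutionOfSingularities.Theorems.FrobeniusLadderFRationalResolutionChartFactsOfReduction
import Summits.ResolutionOfSingularities.ResolutionOfSingularities.Theorems.FrobeniusLadderFRationalResolutionChartFactsFiniteCriterion
import HarnessLib

/-!
# Crux `FrobeniusLadder.FRationalResolution` (stmt-ResolutionOfSingularities-15317), line `redirect`,
# stub `stub_diagonalizableQuotientResolution` — THE PER-CLASS INTERFACE OF THE NAIVE TWO-STEP RECIPE: what a class certificate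
# must contain after p843151–p843394 (reduction charts only; on each, regularity away from finitely many elements, one vertex,
# one point blow-up)

Assembly of `…ChartFactsOfReduction.chartFacts_of_reduction` (p843390) and `…ChartFactsFiniteCriterion.chartFacts_of_away_regular_of_pow_le`
into the hypotheses `hfinm` / `hmodel` of the fixed-point consumer `…FixedPointTwoStepModel.hasResolution_of_isolated_fixedPoints_of_two_step_chart'`
(p843344). A CLASS CERTIFICATE for the model `(T, 𝔳)` and the centre `J = 𝔳^{b+1} = (x₁,…,x_n)` consists of:
* a reduction `y₁,…,y_m ∈ J` of `J` (`J^{N+1} ⊆ (y) J^N`; for a monomial `J`: the vertices of its Newton polyhedron);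
* on each reduction chart `C = T[J/yⱼ]`: a set `G ⊆ C` with every `C[1/g]` (`g ∈ G`) a regular ring (for a toric chart: the
  monomial generators — the proper faces of the chart cone are regular), a maximal `𝔪` with `𝔪^M ⊆ 𝔳C + (G)` (the vertex, `M = 1`),
  and — only if `C_𝔪` is not regular — the regularity of ONE point blow-up `Bl_𝔪(Spec C_𝔪)` (by `…LocalToricModelBlowupAtPrime`:
  chart data at `𝔪` + a vertex certificate, free for Veronese cones).

* ★★★ `chartFacts_of_certificate` — such a certificate ⇒ the chart facts on ALL charts `T[J/xᵢ]`;
* ★★★ `hasResolution_of_isolated_fixedPoints_of_certificate` — the fixed-point consumer with the certificate in place of the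
  chart facts.

Honest label: assembly toward ONE leaf stub (no stub, crux or summit closed). No definitions, no named facts, no sorry.
[cite: GortzWedhorn2020, (13.19) p. 415] [cite: Matsumura1987, Thm. 19.3; §32] [cite: Kato1994, Thm. (3.2)] [cite: Kollar2007, §2.2]
-/

noncomputable section

-- single-problem summit: the doubled namespace component is forced
set_option linter.dupNamespace false

open CategoryTheory AlgebraicGeometry TopologicalSpace IsLocalRing
open Literature.AlgebraicGeometry.Resolution

namespace Summit.ResolutionOfSingularities.ResolutionOfSingularities.Theorems.FRationalResolution.TwoStepChartFactsInterface

/-- ★★★ **THE CHART FACTS FROM A CLASS CERTIFICATE.** `T` a commutative ring, `𝔳, J ⊆ T`, `xᵢ ∈ J` (the charts the consumers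
want), `yⱼ ∈ J` a reduction of `J`; on each `C = T[J/yⱼ]` a set `G` of elements with regular `C[1/g]`, a maximal `𝔪` with
`𝔪^M ⊆ 𝔳C + (G)` and the point blow-up at `𝔪` regular if `C_𝔪` is not. Then every `T[J/xᵢ]` has finitely many non-regular primes
over `𝔳`, at each of which the point blow-up is regular. [cite: GortzWedhorn2020, (13.19) p. 415] [cite: Matsumura1987, Thm. 19.3] -/
theorem chartFacts_of_certificate {T : Type} [CommRing T] (𝔳 J : Ideal T) {n : ℕ} (x : Fin n → T) (hxJ : ∀ i, x i ∈ J)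
    {m : ℕ} (y : Fin m → T) (hyJ : ∀ j, y j ∈ J) {N : ℕ} (hred : J ^ (N + 1) ≤ Ideal.span (Set.range y) * J ^ N)
    (hcert : ∀ j : Fin m, ∃ (G : Set (blowupAlgebra J (y j))) (𝔪 : Ideal (blowupAlgebra J (y j))) (_ : 𝔪.IsMaximal) (M : ℕ),
      (∀ g ∈ G, IsRegularRing (Localization.Away g)) ∧
      𝔪 ^ M ≤ 𝔳.map (algebraMap T (blowupAlgebra J (y j))) ⊔ Ideal.span G ∧
      (¬ IsRegularLocalRing (Localization.AtPrime 𝔪) →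
        Scheme.IsRegular (affineBlowup (R := Localization.AtPrime 𝔪) (maximalIdeal (Localization.AtPrime 𝔪))))) :
    (∀ i : Fin n, {𝔫 : PrimeSpectrum (blowupAlgebra J (x i)) |
      𝔳.map (algebraMap T (blowupAlgebra J (x i))) ≤ 𝔫.asIdeal ∧
        ¬ IsRegularLocalRing (Localization.AtPrime 𝔫.asIdeal)}.Finite) ∧
    (∀ (i : Fin n) (𝔫 : PrimeSpectrum (blowupAlgebra J (x i))),
      𝔳.map (algebraMap T (blowupAlgebra J (x i))) ≤ 𝔫.asIdeal →
      ¬ IsRegularLocalRing (Localization.AtPrime 𝔫.asIdeal) →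
      Scheme.IsRegular (affineBlowup (R := Localization.AtPrime 𝔫.asIdeal)
        (maximalIdeal (Localization.AtPrime 𝔫.asIdeal)))) := by
  -- the chart facts on the reduction charts
  have hy : ∀ j : Fin m,
      {𝔫 : PrimeSpectrum (blowupAlgebra J (y j)) |
        𝔳.map (algebraMap T (blowupAlgebra J (y j))) ≤ 𝔫.asIdeal ∧
          ¬ IsRegularLocalRing (Localization.AtPrime 𝔫.asIdeal)}.Finite ∧
      ∀ 𝔫 : PrimeSpectrum (blowupAlgebra J (y j)),
        𝔳.map (algebraMap T (blowupAlgebra J (y j))) ≤ 𝔫.asIdeal →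
        ¬ IsRegularLocalRing (Localization.AtPrime 𝔫.asIdeal) →
        Scheme.IsRegular (affineBlowup (R := Localization.AtPrime 𝔫.asIdeal)
          (maximalIdeal (Localization.AtPrime 𝔫.asIdeal))) := by
    intro j
    obtain ⟨G, 𝔪, _, M, hG, hM, hbl⟩ := hcert j
    have h := ChartFactsFiniteCriterion.chartFacts_of_away_regular_of_pow_le
      (𝔳.map (algebraMap T (blowupAlgebra J (y j)))) (Subtype.val : G → blowupAlgebra J (y j))
      (fun g => hG g.1 g.2) 𝔪 (N := M) (by rwa [Subtype.range_coe_subtype, Set.setOf_mem_eq]) hbl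
    exact h
  exact ChartFactsOfReduction.chartFacts_of_reduction 𝔳 J x hxJ y hyJ hred (fun j => (hy j).1) (fun j => (hy j).2)

variable {k' : Type} [Field k'] {A : Type} [DecidableEq A] [AddCommGroup A] {S : Type}
  [CommRing S] [Algebra k' S] (𝒮 : A → Submodule k' S) [GradedAlgebra 𝒮]

/-- ★★★ **RESOLUTION OF VARIETIES WHOSE SINGULAR POINTS ARE ISOLATED FIXED POINTS OF QUOTIENT CHARTS CARRYING A CLASS CERTIFICATE.**
`…FixedPointTwoStepModel.hasResolution_of_isolated_fixedPoints_of_two_step_chart'` with the chart facts replaced by the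
certificate of `chartFacts_of_certificate`: at each singular point, fixed-point data, a charted model `(T, 𝔳, χ)` over `κ(𝔮)`,
generators `x` of `𝔳^{b+1}`, a reduction `y` and the per-chart certificates.
[cite: Kato1994, Thm. (3.2)] [cite: Kollar2007, §2.2] [cite: GortzWedhorn2020, (13.19) p. 415] [cite: Matsumura1987, Thm. 19.3; §32] -/
theorem hasResolution_of_isolated_fixedPoints_of_certificate (k : Type) [Field k] (X : Scheme.{0}) [IsIntegral X]
    (f : X ⟶ Spec (.of k)) [LocallyOfFiniteType f] (hfin : (Scheme.regularLocus X)ᶜ.Finite)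
    (hchart : ∀ t : X, t ∉ Scheme.regularLocus X →
      ∃ (k' : Type) (_ : Field k') (A : Type) (_ : DecidableEq A) (_ : AddCommGroup A) (_ : AddMonoid.IsTorsion A)
        (S : Type) (_ : CommRing S) (_ : Algebra k' S) (𝒮 : A → Submodule k' S) (_ : GradedAlgebra 𝒮)
        (_ : Algebra.FiniteType k' S) (φ : Spec (.of (𝒮 0)) ⟶ X) (_ : Etale φ)
        (𝔔 : Ideal S) (_ : 𝔔.IsPrime) (_ : ∀ a : A, a ≠ 0 → ∀ s ∈ 𝒮 a, s ∈ 𝔔)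
        (n : ℕ) (x : Fin n → S) (a : Fin n → A) (P : AddSubmonoid (Fin n →₀ ℕ))
        (_ : ∀ i, x i ∈ 𝔔 ∧ x i ∈ 𝒮 (a i))
        (_ : Ideal.span (algebraMap S (Localization.AtPrime 𝔔) '' Set.range x) = maximalIdeal (Localization.AtPrime 𝔔))
        (_ : (n : WithBot ℕ∞) = ringKrullDim (Localization.AtPrime 𝔔))
        (_ : ∀ m, m ∈ P ↔ Finsupp.weight a m = 0)
        (T : Type) (_ : CommRing T) (_ : Algebra (ResidueField (Localization.AtPrime (𝔔.comap (algebraMap (𝒮 0) S)))) T)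
        (_ : Algebra.FiniteType (ResidueField (Localization.AtPrime (𝔔.comap (algebraMap (𝒮 0) S)))) T)
        (𝔳 : Ideal T) (_ : 𝔳.IsMaximal)
        (_ : ∀ z : Localization.AtPrime 𝔳, ∃ c : ResidueField (Localization.AtPrime (𝔔.comap (algebraMap (𝒮 0) S))),
          z - algebraMap _ (Localization.AtPrime 𝔳) c ∈ maximalIdeal (Localization.AtPrime 𝔳))
        (χ : (Fin n →₀ ℕ) → T) (_ : χ 0 = 1) (_ : ∀ p ∈ P, ∀ q ∈ P, χ (p + q) = χ p * χ q)
        (_ : ∀ p ∈ P, p ≠ 0 → χ p ∈ 𝔳) (_ : 𝔳 ≤ Ideal.span (χ '' {p | p ∈ P ∧ p ≠ 0}))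
        (_ : ringKrullDim (Localization.AtPrime 𝔳) = n)
        (b nx : ℕ) (xv : Fin nx → T) (_ : 𝔳 ^ (b + 1) = Ideal.span (Set.range xv))
        (m : ℕ) (y : Fin m → T) (_ : ∀ j, y j ∈ 𝔳 ^ (b + 1)) (N : ℕ)
        (_ : (𝔳 ^ (b + 1)) ^ (N + 1) ≤ Ideal.span (Set.range y) * (𝔳 ^ (b + 1)) ^ N),
        φ ⟨𝔔.comap (algebraMap (𝒮 0) S), inferInstance⟩ = t ∧
        ∀ j : Fin m, ∃ (G : Set (blowupAlgebra (𝔳 ^ (b + 1)) (y j))) (𝔪 : Ideal (blowupAlgebra (𝔳 ^ (b + 1)) (y j)))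
          (_ : 𝔪.IsMaximal) (M : ℕ),
          (∀ g ∈ G, IsRegularRing (Localization.Away g)) ∧
          𝔪 ^ M ≤ 𝔳.map (algebraMap T (blowupAlgebra (𝔳 ^ (b + 1)) (y j))) ⊔ Ideal.span G ∧
          (¬ IsRegularLocalRing (Localization.AtPrime 𝔪) →
            Scheme.IsRegular (affineBlowup (R := Localization.AtPrime 𝔪) (maximalIdeal (Localization.AtPrime 𝔪))))) :
    Scheme.HasResolution X := by
  refine FixedPointTwoStepModel.hasResolution_of_isolated_fixedPoints_of_two_step_chart' k X f hfin fun t ht => ?_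
  obtain ⟨k', ik, A, iA₁, iA₂, hA, S, iS₁, iS₂, 𝒮, i𝒮, iS₃, φ, iφ, 𝔔, i𝔔, hfix, n, x, a, P, hxa, hspan, hn, hP, T, iT₁,
    iT₂, iT₃, 𝔳, i𝔳, hres, χ, hχ0, hχadd, hχm, hgen, hdim, b, nx, xv, hxv, m, y, hyJ, N, hred, hφt, hcert⟩ := hchart t ht
  have hxvJ : ∀ i, xv i ∈ 𝔳 ^ (b + 1) := fun i => hxv ▸ Ideal.subset_span ⟨i, rfl⟩
  obtain ⟨hfinm, hmodel⟩ := chartFacts_of_certificate 𝔳 (𝔳 ^ (b + 1)) xv hxvJ y hyJ hred hcert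
  exact ⟨k', ik, A, iA₁, iA₂, hA, S, iS₁, iS₂, 𝒮, i𝒮, iS₃, φ, iφ, 𝔔, i𝔔, hfix, n, x, a, P, hxa, hspan, hn, hP, T, iT₁, iT₂,
    iT₃, 𝔳, i𝔳, hres, χ, hχ0, hχadd, hχm, hgen, hdim, b, nx, xv, hxv, hfinm, hφt, hmodel⟩

end Summit.ResolutionOfSingularities.ResolutionOfSingularities.Theorems.FRationalResolution.TwoStepChartFactsInterface

end
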